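import Literature.RingTheory.CohomologyAnnihilator.AnnihilationOfCohomologyProofs
import Mathlib.RingTheory.Ideal.Maximal
import HarnessLib

/-!
# Local–global principle for the cohomology annihilator in a fixed degree

Topic: `Literature/RingTheory/CohomologyAnnihilator`. For a commutative noetherian ring `C`,
membership in the degree-`n` cohomology annihilator `caⁿ(C)` ([IyengarTakahashi2014, Def. 2.1])
is tested at the maximal ideals WITH THE SAME `n`:

* `mem_cohomologyAnnihilatorOfDegree_of_forall_isMaximal` — if `x/1 ∈ caⁿ(C_𝔪)` for every
  maximal ideal `𝔪`, then `x ∈ caⁿ(C)`;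
* `mem_cohomologyAnnihilatorOfDegree_iff_forall_isMaximal` — together with
  [IyengarTakahashi2014, Lemma 2.10 (1)] (`caⁿ(C)·C_𝔪 ⊆ caⁿ(C_𝔪)`, tree
  `map_cohomologyAnnihilatorOfDegree_le_of_isLocalization`) this is an `iff`;
* `smul_ext_eq_zero_of_forall_isMaximal` — the underlying statement for one class: if for every
  maximal `𝔪` some `u ∉ 𝔪` kills `x • e`, then `x • e = 0`.

Proof (folklore; the mechanism of [IyengarTakahashi2014, Lemma 2.10 and Theorem 4.3, proof]:
"`Extⁿ_Λ(M, N)_𝔭 ≅ Extⁿ_{Λ_𝔭}(M_𝔭, N_𝔭)` … for any finitely generated module `E` one has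
`E_𝔭 = 0` iff `ann E ⊄ 𝔭`"): for finitely generated `M`, `N`, `i ≥ n` and `e ∈ Extⁱ_C(M, N)`, the
image of `x • e` in `Extⁱ_{C_𝔪}(M_𝔪, N_𝔪)` is `(x/1) • ē = 0` (`extLocalizationMap_smul`; the
localised modules are finitely generated), so by the injectivity half of the localisation of `Ext`
(tree `exists_smul_eq_zero_of_extLocalizationMap_eq_zero`) some `u ∉ 𝔪` kills `x • e`; hence the
annihilator of `x • e` lies in no maximal ideal, i.e. `x • e = 0`. NOTE: the union
`ca(C) = ⋃ₙ caⁿ(C)` does NOT satisfy the analogous principle without a uniform `n`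
(the degree may be unbounded along the maximal spectrum).

## References

* S. B. Iyengar, R. Takahashi, *Annihilation of cohomology and strong generation of module
  categories*, IMRN 2016; arXiv:1404.1476 — Definition 2.1, Lemma 2.10, Theorem 4.3 (proof).
  [`IyengarTakahashi2014`]
-/

noncomputable section

open CategoryTheory CategoryTheory.Abelian

universe u

namespace Literature.RingTheory.CohomologyAnnihilator

variable {C : Type u} [CommRing C]

/-- An element of a module that is killed, for every maximal ideal `𝔪`, by some scalar outside
`𝔪` is zero: its annihilator is contained in no maximal ideal. [folklore] -/
private theorem eq_zero_of_forall_isMaximal_exists_smul_eq_zero {E : Type*} [AddCommGroup E] [Module C E]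
    (e : E) (h : ∀ (𝔪 : Ideal C) [𝔪.IsMaximal], ∃ u ∉ 𝔪, u • e = 0) : e = 0 := by
  by_contra hne
  have hI : (Submodule.span C {e}).annihilator ≠ ⊤ := by
    intro htop
    have h1 : (1 : C) ∈ (Submodule.span C {e}).annihilator := by rw [htop]; trivial
    have := Submodule.mem_annihilator.mp h1 e (Submodule.mem_span_singleton_self e)
    rw [one_smul] at this
    exact hne this
  obtain ⟨𝔪, h𝔪, hle⟩ := Ideal.exists_le_maximal _ hI
  obtain ⟨u, hu, hue⟩ := h 𝔪
  refine hu (hle (Submodule.mem_annihilator.mpr fun y hy => ?_))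
  obtain ⟨a, rfl⟩ := Submodule.mem_span_singleton.mp hy
  rw [smul_comm, hue, smul_zero]

/-- **One class.** Over a noetherian ring `C`, for finitely generated `M` and a class
`e ∈ Extⁱ_C(M, N)`: if the image of `x` kills the image of `e` in `Extⁱ_{C_𝔪}(M_𝔪, N_𝔪)` for every
maximal ideal `𝔪`, then `x • e = 0`. (Injectivity half of the localisation of `Ext`,
[IyengarTakahashi2014, Lemma 2.10 (proof)].) [cite: IyengarTakahashi2014, Lemma 2.10] -/
theorem smul_ext_eq_zero_of_forall_isMaximal [IsNoetherianRing C] {M N : ModuleCat.{u} C}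
    [Module.Finite C M] {i : ℕ} (x : C) (e : Ext.{u} M N i)
    (h : ∀ (𝔪 : Ideal C) [𝔪.IsMaximal],
      algebraMap C (Localization.AtPrime 𝔪) x •
        extLocalizationMap 𝔪.primeCompl M N i e = 0) :
    x • e = 0 := by
  refine eq_zero_of_forall_isMaximal_exists_smul_eq_zero (C := C) (x • e) fun 𝔪 _ => ?_
  have h0 : extLocalizationMap 𝔪.primeCompl M N i (x • e) = 0 := by
    rw [extLocalizationMap_smul]
    exact h 𝔪
  obtain ⟨u, hu⟩ :=
    exists_smul_eq_zero_of_extLocalizationMap_eq_zero 𝔪.primeCompl i M N ‹_› (x • e) h0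
  exact ⟨u, u.2, hu⟩

/-- **Local–global principle for `caⁿ`, fixed degree.** For a commutative noetherian ring `C`,
`x : C` and `n : ℕ`: if `x/1 ∈ caⁿ(C_𝔪)` for every maximal ideal `𝔪`, then `x ∈ caⁿ(C)` — with the
SAME `n`. For finitely generated `M`, `N`, `i ≥ n`, `e ∈ Extⁱ_C(M, N)`: `M_𝔪`, `N_𝔪` are finitely
generated over `C_𝔪`, so `(x/1) • ē = 0` there, and `smul_ext_eq_zero_of_forall_isMaximal` applies.
[cite: IyengarTakahashi2014, Lemma 2.10] -/
theorem mem_cohomologyAnnihilatorOfDegree_of_forall_isMaximal [IsNoetherianRing C] (x : C) (n : ℕ)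
    (h : ∀ (𝔪 : Ideal C) [𝔪.IsMaximal],
      algebraMap C (Localization.AtPrime 𝔪) x ∈
        cohomologyAnnihilatorOfDegree (Localization.AtPrime 𝔪) n) :
    x ∈ cohomologyAnnihilatorOfDegree C n := by
  rw [mem_cohomologyAnnihilatorOfDegree_iff]
  intro i hi M N hM hN e
  refine smul_ext_eq_zero_of_forall_isMaximal x e fun 𝔪 _ => ?_
  haveI : Module.Finite (Localization.AtPrime 𝔪) (M.localizedModule 𝔪.primeCompl) :=
    Module.Finite.of_isLocalizedModule 𝔪.primeCompl (M.localizedModuleMkLinearMap 𝔪.primeCompl)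
  haveI : Module.Finite (Localization.AtPrime 𝔪) (N.localizedModule 𝔪.primeCompl) :=
    Module.Finite.of_isLocalizedModule 𝔪.primeCompl (N.localizedModuleMkLinearMap 𝔪.primeCompl)
  exact smul_eq_zero_of_mem_cohomologyAnnihilatorOfDegree (h 𝔪) hi _

/-- **Local–global principle for `caⁿ`, as an `iff`**: over a noetherian ring, `x ∈ caⁿ(C)` iff
`x/1 ∈ caⁿ(C_𝔪)` for every maximal ideal `𝔪` (`→` is [IyengarTakahashi2014, Lemma 2.10 (1)],
tree `algebraMap_mem_cohomologyAnnihilatorOfDegree`). [cite: IyengarTakahashi2014, Lemma 2.10] -/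
theorem mem_cohomologyAnnihilatorOfDegree_iff_forall_isMaximal [IsNoetherianRing C] (x : C)
    (n : ℕ) :
    x ∈ cohomologyAnnihilatorOfDegree C n ↔
      ∀ (𝔪 : Ideal C) [𝔪.IsMaximal],
        algebraMap C (Localization.AtPrime 𝔪) x ∈
          cohomologyAnnihilatorOfDegree (Localization.AtPrime 𝔪) n :=
  ⟨fun hx 𝔪 _ => algebraMap_mem_cohomologyAnnihilatorOfDegree 𝔪.primeCompl hx,
    mem_cohomologyAnnihilatorOfDegree_of_forall_isMaximal x n⟩

/-- **Local–global principle at the primes** (weaker hypothesis form often at hand): if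
`x/1 ∈ caⁿ(C_𝔭)` for every PRIME `𝔭`, then `x ∈ caⁿ(C)`. [cite: IyengarTakahashi2014, Lemma 2.10] -/
theorem mem_cohomologyAnnihilatorOfDegree_of_forall_isPrime [IsNoetherianRing C] (x : C) (n : ℕ)
    (h : ∀ (𝔭 : Ideal C) [𝔭.IsPrime],
      algebraMap C (Localization.AtPrime 𝔭) x ∈
        cohomologyAnnihilatorOfDegree (Localization.AtPrime 𝔭) n) :
    x ∈ cohomologyAnnihilatorOfDegree C n :=
  mem_cohomologyAnnihilatorOfDegree_of_forall_isMaximal x n fun 𝔪 _ => h 𝔪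

/-- **Bounded-degree local–global for `ca`**: if there is ONE `n` with `x/1 ∈ caⁿ(C_𝔪)` for all
maximal `𝔪`, then `x ∈ ca(C)`. (Without a uniform bound the conclusion can fail: the degree of
annihilation may be unbounded along `Max C`.) [cite: IyengarTakahashi2014, Lemma 2.10] -/
theorem mem_cohomologyAnnihilator_of_forall_isMaximal [IsNoetherianRing C] (x : C) (n : ℕ)
    (h : ∀ (𝔪 : Ideal C) [𝔪.IsMaximal],
      algebraMap C (Localization.AtPrime 𝔪) x ∈
        cohomologyAnnihilatorOfDegree (Localization.AtPrime 𝔪) n) :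
    x ∈ cohomologyAnnihilator C :=
  mem_cohomologyAnnihilator_iff.mpr ⟨n, mem_cohomologyAnnihilatorOfDegree_of_forall_isMaximal x n h⟩

end Literature.RingTheory.CohomologyAnnihilator

end
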